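import Summits.CriticalPhenomena.CardyFormulaZ2.Theorems.CardyIKTransportIKLinearTransportStubRowCFTPDynamics

/-!
# Stub `stub_RowCFTP` (A_dyn) — part R: WHAT REMAINS — a coalescing, quasi-local VERSION of the row kernel

Theorem-only support file (`--supports stmt-CriticalPhenomena-5076`, registered sub-goal
`rowCFTP_of_coalescingRowKernel`). With the exact heat-bath dynamics `rowDyn i U G` of part D
(`exists_exactRowDynamics`: measurable, writes one row, covariant surely, reads its own row's bits, reads the
start below its row, EXACT — for ANY row kernel `G` satisfying the kernel identity
`law (rowStat x, G (rowStat x, U u)) = law (rowStat x, x)` under `νmix (S ∆ {i,i+1}) ⊗ β`), the registered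
signature of `stub_RowCFTP` follows (sorry-free, below) from

  (A_dyn') `∃ C c, 0 < c ∧ ∀ S i, (i ∈ S ↔ i+1 ∉ S) → StripDiagramExchange S i → ∃ U G Coal,`
           `U` uniform-level-like (measurable, cell-local, covariant) `∧ Measurable G ∧` kernel identity `∧`
           `Coal` measurable, SOUND FOR `rowDyn i U G`, with tails `C e^{-cm}` under `νmix S ⊗ β`, covariant `∧`
           `2r`-local approximants of the depth-`r` sweeps of `rowDyn i U G` off probability `C e^{-cr}`,

i.e. from the CHOICE OF A VERSION of the conditional row law (the kernel identity fixes `G (t, ·)` only for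
`law(rowStat)`-a.e. statistic value `t`; the blank start `p.1` of the coupling-from-the-past sampler and every
start met before coalescence are impossible pasts — a null set — on which `G` must be DEFINED so that the
grand coupling still coalesces) together with the two in-mean mixing estimates of the diagram-conditioned
transfer-matrix chain: exponential tails of the coalescence depth of the grand (quantile) coupling, and
exponential locality of the backward messages. The audit of this wave (exact transfer-matrix numerics,
3000 environments × 60 rows, both type orders): at the rows `y` with equal boundary colours the minimum
over the reachable DP states of the conditional probability of the monochromatic ("synchronising") row is
either `0` or `≥ 0.335` (order hc,iso) / `≥ 3/7` (order iso,hc) — never in between —, such rows have density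
`≈ 0.3`, and the in-mean tail of the coalescence depth of the grand coupling from ALL states (garbage starts
absorbed at the first synchronising row) is `0.24, 4.7e-2, 8e-3, 1.5e-3` at `m = 4, 8, 12, 16`
(rate `≈ e^{-0.4 m}`); the locality of the coupled sweep was measured by the refuter (`0.45 e^{-1.1 r}`).
-/

noncomputable section

namespace Summit.CriticalPhenomena.CardyFormulaZ2.Theorems.IKLinearTransport.PinnedDiagramExchange

open scoped Classical MeasureTheory ENNReal symmDiff
open Set MeasureTheory
open Literature.Probability.Percolation Literature.Probability.LatticeModels

/-- `stub_RowCFTP` FROM A COALESCING, QUASI-LOCAL VERSION OF THE ROW KERNEL (registered sub-goal): if for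
every admissible `(S, i)` some row kernel `G` satisfying the kernel identity (a version of the conditional
law of a middle row of `νmix (S ∆ {i,i+1})` given the pinned statistic and the middle rows below, as a
function of the statistic value and a uniform level) makes the heat-bath dynamics `rowDyn i U G` admit
certified coalescence events with exponential tails in mean and local approximants, with uniform constants,
then (A_dyn) holds verbatim: the exactness, measurability and covariance fields are those of
`rowDyn` (part D), assembled by `isRowCFTP_of_exact_row`. [folklore] -/
theorem rowCFTP_of_coalescingRowKernel :
    (∃ C c : ℝ, 0 < c ∧ ∀ (S : Set ℤ) (i : ℤ), (i ∈ S ↔ i + 1 ∉ S) → StripDiagramExchange S i →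
      ∃ (U : Site 2 → Rnd → ℝ) (G : ((Obs × Set (Site 2 × Site 2)) × Obs) × ℝ → Obs)
        (Coal : ℤ → ℕ → Set ((Obs × Set (Site 2 × Site 2)) × Rnd)),
        (∀ v, Measurable (U v)) ∧
        (∀ v (u u' : Rnd), (∀ k : ℕ, ((v, k) ∈ u ↔ (v, k) ∈ u')) → U v u = U v u') ∧
        (∀ v (m : ℤ) (u : Rnd), U v (ushift m u) = U (v - ![0, m]) u) ∧
        Measurable G ∧
        ((νmix (S ∆ {i, i + 1})).prod β).map
            (fun xu => (rowStat i xu.1, G (rowStat i xu.1, U ![i + 1, 0] xu.2))) =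
          (νmix (S ∆ {i, i + 1})).map (fun x => (rowStat i x, x)) ∧
        (∀ y m, MeasurableSet (Coal y m)) ∧
        (∀ (y : ℤ) (m : ℕ) (p : Obs × Set (Site 2 × Site 2)) (u : Rnd), (p, u) ∈ Coal y m → ∀ z : Obs,
          (![i + 1, y] ∈ (rowSweep (rowDyn i U G) (m + 1) (y - m) p u z).1 ↔
            ![i + 1, y] ∈ (rowSweep (rowDyn i U G) (m + 1) (y - m) p u p.1).1) ∧
          (![i, y] ∈ (rowSweep (rowDyn i U G) (m + 1) (y - m) p u z).2 ↔
            ![i, y] ∈ (rowSweep (rowDyn i U G) (m + 1) (y - m) p u p.1).2) ∧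
          (![i + 1, y] ∈ (rowSweep (rowDyn i U G) (m + 1) (y - m) p u z).2 ↔
            ![i + 1, y] ∈ (rowSweep (rowDyn i U G) (m + 1) (y - m) p u p.1).2)) ∧
        (∀ (y : ℤ) (m : ℕ), ((νmix S).prod β) {xu | (pinnedStat i xu.1, xu.2) ∉ Coal y m} ≤
          ENNReal.ofReal (C * Real.exp (-c * m))) ∧
        (∀ (y : ℤ) (m : ℕ) (k : ℤ) (x : Obs) (u : Rnd),
          (pinnedStat i (vshift k x), ushift k u) ∈ Coal y m ↔ (pinnedStat i x, u) ∈ Coal (y - k) m) ∧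
        (∀ (v : Site 2) (r : ℕ), ∃ Gfin : Obs → Rnd → Obs,
          (∀ (x x' : Obs) (u u' : Rnd),
            (∀ w ∈ ballInf v (2 * r), (w ∈ x.1 ↔ w ∈ x'.1) ∧ (w ∈ x.2 ↔ w ∈ x'.2) ∧
              ∀ k : ℕ, ((w, k) ∈ u ↔ (w, k) ∈ u')) →
            ∀ w ∈ ballInf v r, (w ∈ (Gfin x u).1 ↔ w ∈ (Gfin x' u').1) ∧ (w ∈ (Gfin x u).2 ↔ w ∈ (Gfin x' u').2)) ∧
          ((νmix S).prod β) {xu | ∃ w ∈ ballInf v r,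
            (w 0 = i + 1 ∧ ¬ (w ∈ (rowSweep (rowDyn i U G) (r + 1) (w 1 - r) (pinnedStat i xu.1) xu.2
                (eraseMid i xu.1)).1 ↔ w ∈ (Gfin xu.1 xu.2).1)) ∨
            ((w 0 = i ∨ w 0 = i + 1) ∧ ¬ (w ∈ (rowSweep (rowDyn i U G) (r + 1) (w 1 - r) (pinnedStat i xu.1) xu.2
                (eraseMid i xu.1)).2 ↔ w ∈ (Gfin xu.1 xu.2).2))} ≤ ENNReal.ofReal (C * Real.exp (-c * r)))) →
    ∃ C c : ℝ, 0 < c ∧ ∀ (S : Set ℤ) (i : ℤ), (i ∈ S ↔ i + 1 ∉ S) → StripDiagramExchange S i →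
      ∃ (Φ : ℤ → Obs × Set (Site 2 × Site 2) → Rnd → Obs → Obs)
        (Coal : ℤ → ℕ → Set ((Obs × Set (Site 2 × Site 2)) × Rnd)), IsRowCFTP C c S i Φ Coal := by
  rintro ⟨C, c, hc, h⟩
  refine ⟨C, c, hc, fun S i hSi hX => ?_⟩
  obtain ⟨U, G, Coal, hUm, hUloc, hUcov, hGm, hlaw, hCm, hCs, hCt, hCc, hloc⟩ := h S i hSi hX
  exact ⟨rowDyn i U G, Coal, isRowCFTP_of_exact_row C c S i (rowDyn i U G) Coal (rowDyn_measurable i U G hUm hGm)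
    (rowDyn_writes i U G) (rowDyn_cov i U G) (rowDyn_rd i U G hUloc hUcov) (rowDyn_past i U G)
    (rowDyn_exact i U G S hUm hGm hlaw) hCm hCs hCt hCc hloc⟩

end Summit.CriticalPhenomena.CardyFormulaZ2.Theorems.IKLinearTransport.PinnedDiagramExchange
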